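import Literature.IUT.HodgeArakelov.EtaleThetaDataOfSettingInversionCompanion
import Mathlib.Topology.Instances.ZMod
import Mathlib.Data.ZMod.Basic

/-!
# [IUTchII] Prop 2.2 (ii) at the MODEL: the `ℤ`-REVERSAL `toZ ∘ ι = toZ⁻¹` DERIVED from «`ι̂` acts as `−1` on `Δ_X^ab`»
# (GAP row G-w4d010-2, facet (R1c) ⟸ (R1e′) + (H1))

abc-iut cell (WAVE-5 seat abc-iut-w5-d072, (R1) custody; cone of [IUTchIII] Cor. 3.12; DAG node **IUTchII:Prop2.2(ii)**;
plan/GAP-LEDGER.md D-G-w4d010-2f/2g). S. Mochizuki, *Inter-universal Teichmüller theory II*, kurims manuscript (Dec. 2020),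
Rmk. 2.1.1 (i) p. 65 («the vertex labeled `0` is fixed by `ι_X`»; `ι` reverses the `ℤ`-torsor of irreducible components) and
Prop. 2.2 (ii) p. 66 (claim key `Mochizuki2012`, DISPUTED, D-0012); [EtTh] §1 p. 12 («a natural surjection `Π^tp_X ↠ Z`» whose
kernel is `Π^tp_Y`; «`Δ^tp_X/Δ^tp_Y ≅ Z`»), §2 p. 36 («`ι` … determined by “multiplication by `−1`” on the underlying elliptic
curve») [cite: MochizukiEtTh2009, §1 p.12].

PROOF-ONLY companion (no definitions, no new named fact) of `EtaleThetaDataOfSettingInversion*.lean` (p416287/p416913/p417460)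
and of abc-iut-w4-d014's `Discharge/Sec2InversionFixesDeltaTheta.lean` (p419214: facet (R1e) ⟸ (R1e′)). HERE facet **(R1c)** —
the consumer's `hZ : toZ (ι γ) = (toZ γ)⁻¹` / `hαγ : toLZ (α γ) = −1` — is DERIVED from the SAME single geometric input
**(R1e′) `hinv`: «`ι̂` acts as `−1` on `Δ_X^ab`»** (`∀ g ∈ Δ_X, ι̂ g · g ∈ closure [Δ_X, Δ_X]`, `ι̂ :=` abc-iut-w5-d072's
`TemperedCurve.completionAut ι`), together with the consumer's existing (H1) `PiYddCharacteristic C` and `hι`. No continuity of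
`Π^tp_X/Δ^tp_X → G_K` (`IsOpenMap aug`, GAP G-L2d3-4) is needed. Route:
* §1 (generic `X : TemperedCurve p`) `TemperedCurve.hom_apply_aut_mul_self_of_inversion`: every continuous homomorphism `χ` from
  `Π^tp_X` to a finite discrete ABELIAN group kills `α x · x` for `x ∈ Δ^tp_X` — `χ` extends to `Π_X` (universal property of the
  profinite completion, abc-iut-w5-d139 `IsProfiniteCompletion.exists_extension`), the extension kills `closure [Δ_X,Δ_X]`, and
  `ι_X(α x · x) = α̂(ι_X x)·ι_X x`.
* §2 (`D : ThetaSetting p`) `ThetaSetting.toZ_aut_mul_self_of_inversion`: **`toZ (ι x · x) = 1` for `x ∈ Δ^tp_X`** — apply §1 to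
  `Π^tp_X ↠ ℤ ↠ ℤ/n` for every `n ≥ 1` (continuous: the kernel contains the OPEN `Ker toZ = Π^tp_Y`, root field `isOpen_ker_toZ` =
  «the discreteness of `Z`»); an integer divisible by every `n` is `0`.
* §3 (the model `Π := Π^tp_X̲̲`, abc-iut-L2-t8's `C : E.DoubleUnderline l`): (a) `toLZ_aut_eq_one_of_toLZ_eq_one` — for ANY topological
  automorphism `α` of `Π^tp_X̲̲`, `toLZ y = 1 ⇒ toLZ (α y) = 1` from (H1) alone (`y² ∈ Π^tp_Ÿ̲̲` by `[Π^tp_Y̲̲ : Π^tp_Ÿ̲̲] = 2`, L2-t8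
  `relIndex_GtpYdd_inf`; `α(Π^tp_Ÿ̲̲) = Π^tp_Ÿ̲̲`; `ℤ` torsion-free) — the `Y`-clause; (b) `exists_toLZ_generator_mem_deltaTemp` — a
  `toLZ`-GENERATOR INSIDE `Δ^tp_X ∩ Π^tp_X̲̲` (from `map_toZ_Huu = l·ℤ` and L2-t8's field `map_aug_Ydduu = G_K`); (c) hence
  **`toLZ_inversionAlpha_generator_of_inversion`**: `toLZ (α γ) = −1` for EVERY generator `γ`, `α := inversionAlpha C ι hι` — the
  consumer's `hαγ`; and **`prop22_ii'_model_of_inversion_of_hinv`**: abc-iut-w5-d072's `prop22_ii'_model_of_inversion'` with the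
  binder `hZ` REPLACED by `hinv`.
EFFECT on D-G-w4d010-2g: residual of (R1) = (R1a) `hι` · (R1b′) `hΔ` + `hq` · (R1d) `hind` · (R1e′) `hinv` [(R1c), (R1e) derived].
[claim: Mochizuki2012, status: disputed] Nothing here takes a side on [IUTchIII] Cor. 3.12; typed ≠ proved for the named inputs.
-/

noncomputable section

open Topology

/-! ## §1. Finite abelian quotients kill `α x · x` on `Δ^tp_X` when `α̂` acts as `−1` on `Δ_X^ab` -/

namespace Literature.AnabelianGeometry.SemiGraphs

namespace TemperedCurve

variable {p : ℕ} [Fact p.Prime] (X : TemperedCurve p) (α : X.PiTemp ≃ₜ* X.PiTemp)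

/-- A group homomorphism into a DISCRETE group whose kernel is open is continuous. [folklore] -/
private theorem continuous_of_isOpen_ker {G H : Type*} [Group G] [TopologicalSpace G] [IsTopologicalGroup G] [Group H]
    [TopologicalSpace H] [DiscreteTopology H] (f : G →* H) (hk : IsOpen (f.ker : Set G)) : Continuous f := by
  apply continuous_of_tendsto_nhds_one
  rw [congrFun (nhds_discrete H) 1, Filter.tendsto_pure]
  exact Filter.mem_of_superset (hk.mem_nhds (one_mem f.ker)) (fun x hx => hx)

/-- **If `α̂` acts as `−1` on `Δ_X^ab`, every continuous homomorphism `χ : Π^tp_X → Q` to a finite discrete abelian group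
satisfies `χ (α x · x) = 1` for `x ∈ Δ^tp_X`** ([EtTh] p. 36 «multiplication by `−1`»; [SemiAnbd] §6 p. 69): `χ` extends to
`Φ : Π_X → Q` along `ι_X` (universal property of the profinite completion), `Φ` kills the CLOSED normal subgroup
`closure [Δ_X, Δ_X]` (abelian Hausdorff target), and `ι_X(α x · x) = α̂(ι_X x) · ι_X x` lies there by `hinv` (`ι_X x ∈ Δ_X`).
[cite: MochizukiEtTh2009, Prop 2.2 (i) p.37] -/
theorem hom_apply_aut_mul_self_of_inversion
    (hinv : ∀ g ∈ X.DeltaHat, X.completionAut α g * g ∈ (⁅X.DeltaHat, X.DeltaHat⁆).topologicalClosure)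
    {Q : Type} [CommGroup Q] [TopologicalSpace Q] [DiscreteTopology Q] [CompactSpace Q] (χ : X.PiTemp →ₜ* Q)
    (x : X.PiTemp) (hx : x ∈ X.DeltaTemp) : χ (α x * x) = 1 := by
  obtain ⟨Φ, hΦ⟩ := IsProfiniteCompletion.exists_extension X.isProfiniteCompletion_toHat χ
  -- `Φ` kills the closure of `[Δ_X, Δ_X]`
  have hker : (⁅X.DeltaHat, X.DeltaHat⁆).topologicalClosure ≤ Φ.toMonoidHom.ker := by
    have hcl : IsClosed ((Φ.toMonoidHom.ker : Subgroup X.PiHat) : Set X.PiHat) := by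
      change IsClosed ((Φ : X.PiHat → Q) ⁻¹' {1})
      exact (isClosed_discrete _).preimage Φ.continuous
    refine (Subgroup.topologicalClosure_minimal _ ?_ hcl)
    rw [Subgroup.commutator_le]
    intro a _ b _
    rw [MonoidHom.mem_ker]
    change Φ (a * b * a⁻¹ * b⁻¹) = 1
    rw [map_mul, map_mul, map_mul, map_inv, map_inv, mul_inv_cancel_comm, mul_inv_cancel]
  -- `ι_X x ∈ Δ_X`, so `α̂(ι_X x) · ι_X x` lies in that closure
  have hxhat : X.toHat x ∈ X.DeltaHat := by
    unfold DeltaHat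
    exact Subgroup.le_topologicalClosure _ ⟨x, hx, rfl⟩
  have hmem := hker (hinv _ hxhat)
  rw [MonoidHom.mem_ker, completionAut_toHat] at hmem
  change Φ (X.toHat (α x) * X.toHat x) = 1 at hmem
  rw [← map_mul, hΦ] at hmem
  exact hmem

end TemperedCurve

end Literature.AnabelianGeometry.SemiGraphs

/-! ## §2. At the theta setting: `toZ (ι x) = (toZ x)⁻¹` on `Δ^tp_X` -/

namespace Literature.AnabelianGeometry.EtaleTheta

namespace ThetaSetting

open Literature.AnabelianGeometry.SemiGraphs

variable {p : ℕ} [Fact p.Prime] (D : ThetaSetting p) (ι : D.PiTemp ≃ₜ* D.PiTemp)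
  (hinv : ∀ g ∈ D.toTemperedCurve.DeltaHat, D.toTemperedCurve.completionAut ι g * g ∈
    (⁅D.toTemperedCurve.DeltaHat, D.toTemperedCurve.DeltaHat⁆).topologicalClosure)

/-- An integer which vanishes in `ℤ/n` for every `n ≥ 1` is `0`. [folklore] -/
private theorem int_eq_zero_of_forall_zmod_eq_zero (z : ℤ) (h : ∀ n : ℕ, 0 < n → ((z : ZMod n) = 0)) : z = 0 := by
  have h1 := h (z.natAbs + 1) (Nat.succ_pos _)
  rw [ZMod.intCast_zmod_eq_zero_iff_dvd] at h1
  exact Int.eq_zero_of_dvd_of_natAbs_lt_natAbs h1 (by rw [Int.natAbs_natCast]; exact Nat.lt_succ_self _)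

/-- The composite `Π^tp_X ↠ Z = ℤ ↠ ℤ/n` as a CONTINUOUS homomorphism: its kernel contains the open `Π^tp_Y = Ker toZ` (root
field `isOpen_ker_toZ`, «the discreteness of the topological group `Z`», [EtTh] proof of Thm. 1.6 (i) p. 24).
[cite: MochizukiEtTh2009, §1 p.12] -/
theorem continuous_toZMod (n : ℕ) :
    Continuous ((AddMonoidHom.toMultiplicative (Int.castAddHom (ZMod n))).comp D.toZ) := by
  refine TemperedCurve.continuous_of_isOpen_ker _ (Subgroup.isOpen_mono ?_ D.isOpen_ker_toZ)
  intro x hx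
  rw [MonoidHom.mem_ker] at hx ⊢
  rw [MonoidHom.comp_apply, hx, map_one]

include hinv in
/-- **`toZ (ι x · x) = 1` (i.e. `toZ (ι x) = (toZ x)⁻¹`) for every `x ∈ Δ^tp_X`**, when `ι̂` acts as `−1` on `Δ_X^ab` ([EtTh] p. 12
«`Δ^tp_X/Δ^tp_Y ≅ Z`», p. 36 «multiplication by `−1`»; [IUTchII] Rmk. 2.1.1 (i)): by §1 the integer `toZ (ι x · x)` vanishes in
every `ℤ/n`. [cite: MochizukiEtTh2009, §1 p.12] -/
theorem toZ_aut_mul_self_of_inversion (x : D.PiTemp) (hx : x ∈ D.DeltaTemp) : D.toZ (ι x * x) = 1 := by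
  have key : Multiplicative.toAdd (D.toZ (ι x * x)) = 0 := by
    refine int_eq_zero_of_forall_zmod_eq_zero _ fun n hn => ?_
    haveI : NeZero n := ⟨Nat.pos_iff_ne_zero.mp hn⟩
    let χ : D.PiTemp →ₜ* Multiplicative (ZMod n) :=
      { toMonoidHom := (AddMonoidHom.toMultiplicative (Int.castAddHom (ZMod n))).comp D.toZ
        continuous_toFun := D.continuous_toZMod n }
    have h := D.toTemperedCurve.hom_apply_aut_mul_self_of_inversion ι hinv χ x hx
    exact Multiplicative.ofAdd.injective h
  exact Multiplicative.toAdd.injective key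

include hinv in
/-- `toZ (ι x) = (toZ x)⁻¹` for `x ∈ Δ^tp_X`. [cite: MochizukiEtTh2009, §1 p.12] -/
theorem toZ_aut_eq_inv_of_inversion (x : D.PiTemp) (hx : x ∈ D.DeltaTemp) : D.toZ (ι x) = (D.toZ x)⁻¹ :=
  eq_inv_of_mul_eq_one_left (by rw [← map_mul]; exact D.toZ_aut_mul_self_of_inversion ι hinv x hx)

end ThetaSetting

end Literature.AnabelianGeometry.EtaleTheta

/-! ## §3. At the model `Π := Π^tp_X̲̲`: the `Y`-clause, a generator inside `Δ^tp_X`, and `hαγ` -/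

namespace Literature.IUT.HodgeArakelov

open Literature.AnabelianGeometry.EtaleTheta (ContH1 ThetaSetting)
open EtaleThetaDataOfSetting CohomologySystemOfContH1

namespace EtaleThetaDataOfSetting

variable {p : ℕ} [Fact p.Prime] {D : Literature.AnabelianGeometry.EtaleTheta.ThetaSetting p}
  {E : D.EtaleThetaData} {l : ℕ} (C : E.DoubleUnderline l)

/-- **The `Y`-clause at `Π^tp_X̲̲`**: for ANY topological automorphism `α` of `Π := Π^tp_X̲̲`, `toLZ y = 1 ⇒ toLZ (α y) = 1` — from
(H1) `PiYddCharacteristic C` alone: `y ∈ Π^tp_Y̲̲ = Ker toLZ` (L2-t8 `toLZ_ker`) has `y² ∈ Π^tp_Ÿ̲̲` (`[Π^tp_Y̲̲ : Π^tp_Ÿ̲̲] = 2`,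
`relIndex_GtpYdd_inf`), `α` maps `Π^tp_Ÿ̲̲` onto itself, so `toLZ (α y)² = 1` in the torsion-free `ℤ`.
[cite: MochizukiEtTh2009, Def 2.7 p.41] -/
theorem toLZ_aut_eq_one_of_toLZ_eq_one (hS : D.Sec2Hyps) (hchar : PiYddCharacteristic C) (α : (Pi C) ≃ₜ* (Pi C))
    (y : Pi C) (hy : C.toLZ y = 1) : C.toLZ (α y) = 1 := by
  -- `y ∈ Π^tp_Y`
  have hyY : (y : D.PiTemp) ∈ D.GtpY := by
    have := (MonoidHom.mem_ker).mpr hy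
    rw [C.toLZ_ker, Subgroup.mem_subgroupOf] at this
    exact this
  -- `y² ∈ Π^tp_Ÿ̲̲`
  have h2 : (D.GtpYdd.subgroupOf (C.Huu ⊓ D.GtpY)).index = 2 := C.relIndex_GtpYdd_inf hS
  let ay : ↥(C.Huu ⊓ D.GtpY) := ⟨(y : D.PiTemp), Subgroup.mem_inf.mpr ⟨y.2, hyY⟩⟩
  have hsq : ay * ay ∈ D.GtpYdd.subgroupOf (C.Huu ⊓ D.GtpY) := Subgroup.mul_self_mem_of_index_two h2 ay
  rw [Subgroup.mem_subgroupOf] at hsq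
  have hyy : y * y ∈ PiYdd C :=
    Subgroup.mem_subgroupOf.mpr (Subgroup.mem_inf.mpr ⟨hsq, (y * y).2⟩)
  -- `α(y²) ∈ Π^tp_Ÿ̲̲ ⊆ Π^tp_Y̲̲ = Ker toLZ`
  have hαyy : α (y * y) ∈ PiYdd C := (mem_PiYdd_iff_of_piYddCharacteristic C hchar α _).mp hyy
  have hker : α (y * y) ∈ C.toLZ.ker := by
    rw [C.toLZ_ker, Subgroup.mem_subgroupOf]
    exact D.GtpYdd_le_GtpY (Subgroup.mem_subgroupOf.mp hαyy).1
  rw [MonoidHom.mem_ker, map_mul, map_mul] at hker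
  -- `ℤ` is torsion-free
  have h : Multiplicative.toAdd (C.toLZ (α y)) + Multiplicative.toAdd (C.toLZ (α y)) = 0 := by
    rw [← toAdd_mul, hker, toAdd_one]
  have h' : Multiplicative.toAdd (C.toLZ (α y)) = 0 := by omega
  exact Multiplicative.toAdd.injective h'

/-- Hence **`toLZ ∘ α = (·)^k` for ONE integer `k`** (namely `k = toLZ (α γ₀)` at any generator `γ₀`): every `y ∈ Π^tp_X̲̲` is
`γ₀^m · y₀` with `toLZ y₀ = 1`. [cite: MochizukiEtTh2009, Def 2.13 (i) p.47] -/
theorem toLZ_aut_eq_zpow (hS : D.Sec2Hyps) (hchar : PiYddCharacteristic C) (α : (Pi C) ≃ₜ* (Pi C))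
    (γ₀ : Pi C) (hγ₀ : C.toLZ γ₀ = Multiplicative.ofAdd 1) (y : Pi C) :
    C.toLZ (α y) = C.toLZ (α γ₀) ^ Multiplicative.toAdd (C.toLZ y) := by
  set m := Multiplicative.toAdd (C.toLZ y) with hm
  -- `y₀ := γ₀^{-m} · y` has `toLZ y₀ = 1`
  have hy₀ : C.toLZ (γ₀ ^ (-m) * y) = 1 := by
    rw [map_mul, map_zpow, hγ₀, ← ofAdd_zsmul, smul_eq_mul, mul_one, hm, ofAdd_neg, ofAdd_toAdd, inv_mul_cancel]
  have h1 := toLZ_aut_eq_one_of_toLZ_eq_one C hS hchar α _ hy₀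
  rw [map_mul, map_zpow, map_mul, map_zpow, zpow_neg, inv_mul_eq_one] at h1
  exact h1.symm

/-- **A `toLZ`-generator inside `Δ^tp_X ∩ Π^tp_X̲̲`**: some `d ∈ Π^tp_X̲̲` with `aug d = 1` and `toLZ d = 1 ∈ ℤ` (i.e. `toZ d = l`) —
from `toZ(Π^tp_X̲̲) = l·ℤ` (L2-t8 `map_toZ_Huu`/`toLZ_surjective`) and `aug(Π^tp_Ÿ̲̲) = G_K` (L2-t8's field `map_aug_Ydduu`:
correct the `G_K`-component inside `Π^tp_Ÿ̲̲ ⊆ Ker toZ`). [cite: MochizukiEtTh2009, Prop 2.2 (iii) p.37] -/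
theorem exists_toLZ_generator_mem_deltaTemp :
    ∃ d : Pi C, (d : D.PiTemp) ∈ D.DeltaTemp ∧ C.toLZ d = Multiplicative.ofAdd 1 := by
  obtain ⟨h, hh⟩ := C.toLZ_surjective (Multiplicative.ofAdd 1)
  -- correct the Galois component of `h` inside `Π^tp_Ÿ̲̲`
  have hmem : D.aug.toMonoidHom (h : D.PiTemp) ∈ (D.GtpYdd ⊓ C.Huu).map D.aug.toMonoidHom := by
    rw [C.map_aug_Ydduu]
    exact D.aug_mem_GK _
  obtain ⟨h', hh', heq⟩ := hmem
  refine ⟨h * ⟨h', hh'.2⟩⁻¹, ?_, ?_⟩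
  · change ((h : D.PiTemp) * h'⁻¹) ∈ D.aug.toMonoidHom.ker
    rw [MonoidHom.mem_ker, map_mul, map_inv, ← heq, mul_inv_cancel]
  · have hker : (⟨h', hh'.2⟩ : Pi C) ∈ C.toLZ.ker := by
      rw [C.toLZ_ker, Subgroup.mem_subgroupOf]
      exact D.GtpYdd_le_GtpY hh'.1
    rw [MonoidHom.mem_ker] at hker
    rw [map_mul, map_inv, hker, inv_one, mul_one, hh]

section Inversion

variable (ι : D.PiTemp ≃ₜ* D.PiTemp) (hι : C.Huu.map ι.toMulEquiv.toMonoidHom = C.Huu)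
  (hinv : ∀ g ∈ D.toTemperedCurve.DeltaHat, D.toTemperedCurve.completionAut ι g * g ∈
    (⁅D.toTemperedCurve.DeltaHat, D.toTemperedCurve.DeltaHat⁆).topologicalClosure)

include hinv in
/-- **(R1c) from (R1e′): `toLZ (α γ) = −1` for EVERY `toLZ`-generator `γ`**, `α := ι|Π^tp_X̲̲`, when `ι̂` acts as `−1` on `Δ_X^ab`
([IUTchII] Rmk. 2.1.1 (i) «`ι` reverses the `ℤ`-torsor»): the uniform exponent `k` of `toLZ_aut_eq_zpow` is read off at the
generator `d ∈ Δ^tp_X` of `exists_toLZ_generator_mem_deltaTemp`, where §2 gives `toZ (ι d) = (toZ d)⁻¹`, i.e. `k = −1` — VERBATIM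
the consumer's binder `hαγ`. [claim: Mochizuki2012, status: disputed] (IUTchII §2 Rmk 2.1.1 (i), kurims p.65) -/
theorem toLZ_inversionAlpha_generator_of_inversion (hS : D.Sec2Hyps) (hchar : PiYddCharacteristic C) (γ : Pi C)
    (hγ : C.toLZ γ = Multiplicative.ofAdd 1) :
    C.toLZ (inversionAlpha C ι hι γ) = Multiplicative.ofAdd (-1) := by
  obtain ⟨d, hdΔ, hd⟩ := exists_toLZ_generator_mem_deltaTemp C
  -- at the generator `d ∈ Δ^tp_X`: `toLZ (α d) = (toLZ d)⁻¹ = ofAdd (-1)`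
  have hαd : C.toLZ (inversionAlpha C ι hι d) = Multiplicative.ofAdd (-1) :=
    toLZ_inversionAlpha_generator C ι hι d hd (D.toZ_aut_eq_inv_of_inversion ι hinv (d : D.PiTemp) hdΔ)
  -- uniformity: `toLZ (α γ) = toLZ (α d) ^ toLZ γ = ofAdd (-1) ^ 1`
  rw [toLZ_aut_eq_zpow C hS hchar (inversionAlpha C ι hι) d hd γ, hαd, hγ, toAdd_ofAdd, zpow_one]

include hι hinv in
/-- The `ℤ`-reversal in the root's terms: `toZ (ι γ) = (toZ γ)⁻¹` at every `toLZ`-generator `γ ∈ Π^tp_X̲̲` (the binder `hZ` of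
`prop22_ii'_model_of_inversion` / `_of_inversion'`). [claim: Mochizuki2012, status: disputed] (IUTchII §2 Rmk 2.1.1 (i), kurims p.65) -/
theorem toZ_inversion_generator_of_inversion (hS : D.Sec2Hyps) (hchar : PiYddCharacteristic C) (γ : Pi C)
    (hγ : C.toLZ γ = Multiplicative.ofAdd 1) :
    D.toZ (ι (γ : D.PiTemp)) = (D.toZ (γ : D.PiTemp))⁻¹ := by
  have h := toLZ_inversionAlpha_generator_of_inversion C ι hι hinv hS hchar γ hγ
  -- unfold `toLZ = toZ / l` on both elements of `Π^tp_X̲̲`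
  have hz1 : C.zExp (inversionAlpha C ι hι γ) = -1 := by
    have h' := h
    change Multiplicative.ofAdd (C.zExp _) = Multiplicative.ofAdd (-1) at h'
    exact Multiplicative.ofAdd.injective h'
  have hz2 : C.zExp γ = 1 := by
    have h' := hγ
    change Multiplicative.ofAdd (C.zExp _) = Multiplicative.ofAdd 1 at h'
    exact Multiplicative.ofAdd.injective h'
  have e1 : Multiplicative.toAdd (D.toZ (ι (γ : D.PiTemp))) = (l : ℤ) * (-1) := by
    rw [← hz1]
    exact C.toZ_eq (inversionAlpha C ι hι γ)
  have e2 : Multiplicative.toAdd (D.toZ (γ : D.PiTemp)) = (l : ℤ) * 1 := by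
    rw [← hz2]
    exact C.toZ_eq γ
  apply Multiplicative.toAdd.injective
  rw [toAdd_inv, e1, e2]
  ring

include hinv in
/-- **IUTchII:Prop2.2(ii)′ at the model with the `ℤ`-reversal DERIVED** (kurims p. 66): abc-iut-w5-d072's
`prop22_ii'_model_of_inversion'` (p417460) with the binder `hZ` REPLACED by (R1e′) `hinv` («`ι̂` acts as `−1` on `Δ_X^ab`»).
Remaining (R1) inputs: `hι`, `hΔ`, `hq`, `hinv`; plus (R2)(R3). [claim: Mochizuki2012, status: disputed]
(IUTchII §2 Prop 2.2 (ii), kurims pp.65-67) -/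
theorem prop22_ii'_model_of_inversion_of_hinv [hN : (PiYdd C).Normal] (hC : D.Compat) (hS : D.Sec2Hyps)
    (hchar : PiYddCharacteristic C) (S : BadPlaceSetting.{0}) (eS : (Pi C) ≃ₜ* S.PiX) (hl : S.l = l)
    {T : TemperedCoverings S (Pi C)}
    (Dec : SubgraphDecomposition S T (etaleThetaDataOfSetting' C hC hS hchar S.toThetaSetting eS hl))
    (hΔ : D.DeltaTemp.map ι.toMulEquiv.toMonoidHom = D.DeltaTemp) (hq : IsQuotientMap D.toTheta)
    (γ ε : Pi C) (hγ : C.toLZ γ = Multiplicative.ofAdd 1) (hε₁ : (ε : D.PiTemp) ∈ D.GtpY)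
    (hε₂ : (ε : D.PiTemp) ∉ D.GtpYdd)
    (hsign : ∃ κ : ContH1 (phi C) (D.lDeltaTheta l) (PiYdd C ⊓ ⊤), κ ^ 2 = 1 ∧
      ContH1.conj (phi C) (D.lDeltaTheta l) ε (rootLiftClass C) = rootLiftClass C * κ)
    (hroot : ∃ τ₀ : Pi C, (τ₀ : D.PiTemp) ∈ D.GtpY ∧
      inversionTransport C ι hι (D.thetaCompanionOfAut ι hΔ hq) hchar (rootLiftClass C) =
        ContH1.conj (phi C) (D.lDeltaTheta l) τ₀ (rootLiftClass C))
    (hfree : ∀ m n : ℤ, IsOfFinAddOrder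
      ((h1Top C).symm (Additive.ofMul (ContH1.conj (phi C) (D.lDeltaTheta l) (γ ^ m) (rootLiftClass C))) -
        (h1Top C).symm (Additive.ofMul (ContH1.conj (phi C) (D.lDeltaTheta l) (γ ^ n) (rootLiftClass C)))) →
      m = n) :
    Prop22_ii' Dec :=
  prop22_ii'_model_of_inversion' C hC hS hchar S eS hl Dec ι hι hΔ hq γ ε hγ hε₁ hε₂
    (toZ_inversion_generator_of_inversion C ι hι hinv hS hchar γ hγ) hsign hroot hfree

end Inversion

end EtaleThetaDataOfSetting

end Literature.IUT.HodgeArakelov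

end
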